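import Literature.NumberTheory.Automorphic.ZariskiFibreDimension
import Literature.NumberTheory.Automorphic.LowestWeightBorel
import Literature.NumberTheory.Automorphic.CentralizerTorusReductive
import HarnessLib

/-!
# Every element of a connected group lies in a Borel subgroup (Springer 6.4.5 (i)), on `k`-points

Springer, *Linear Algebraic Groups* (2nd ed.), 6.4.5: "*(i) Every element of `G` lies in a Borel
subgroup; … (iii) The union of the Cartan subgroups of `G` contains a dense open subset*", proved
through the dimension count 6.4.4 (ii): for `H` closed with finite index in its normaliser and an
element lying in only finitely many conjugates of `H`, the union of the conjugates of `H` is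
dense. This file proves 6.4.5 (i) in the `k`-points vocabulary of `LinearAlgebraicGroups.lean` /
`ZariskiGL.lean` (`G ≤ GL n k` Zariski-connected over an algebraically closed field, Borel
subgroups `IsBorelIn`, maximal tori `IsMaximalTorusIn`, identity components), by the printed
route, with the dimension theory of `ZariskiFibreDimension.lean` (generic fibres, 5.1.6 (ii)) and
the closedness of the union of the conjugates of a Borel subgroup (6.4.4 (i),
`ParabolicProperties.lean`, from "Borel subgroups are parabolic", 6.2.7 (ii)):

* `ringKrullDim_quotient_vanishingIdeal_image_eq` (isomorphic affine sets have equal dimension),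
  `ringKrullDim_quotient_vanishingIdeal_prodSet` (**`dim (A × W) = dim A + dim W`**, by 5.1.6 (ii)
  for the first projection), `eq_image_of_ringKrullDim_eq_zdim` (1.8.2: a closed irreducible
  subset of `G` of full dimension is `G`);
* `exists_isOpen_torusRegular` (**6.4.3**: regular elements of a torus form a non-empty open
  set), `map_conj_eq_of_regular` (6.4.2 (ii): `g t g⁻¹ ∈ T` with `t` regular forces
  `g ∈ N_G(T)`), `isTorusSubgroup_sup_of_commute`, `exists_isJordanDecomp_mem_of_mem_cartan`
  (6.4.2 (i): the semisimple part of an element of the Cartan subgroup `C = Z_G(T)°` lies in `T`);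
* **`subset_closure_conj_cartan`** (6.4.4 (ii) / 6.4.5 (iii): `⋃_x x C x⁻¹` is dense in `G`):
  the map `ψ : G × C → G`, `(x, c) ↦ x c x⁻¹` has, over the conjugates of the regular elements
  `t₀ u₀` (dense in `G × C`), fibres `{(x₀ m, m⁻¹ c₀ m)}`, finite unions of copies of
  `N_G(T)° ⊆ C` (rigidity 3.2.9), so `dim ψ(G × C)⁻ = dim G + dim C − dim N_G(T)° ≥ dim G`;
* **`IsBorelIn.exists_inv_conj_mem`**, **`exists_isBorelIn_mem`** (**6.4.5 (i)**: every
  `g ∈ G` is conjugate into any Borel subgroup, i.e. lies in a Borel subgroup): the closed union of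
  the conjugates of a Borel subgroup `B ⊇ T` contains the conjugates of `C ⊆ Z_G(T) ⊆ B`
  (6.4.8 (ii), `centralizer_le_of_isBorelIn_holds`); `center_le_of_isBorelIn` (**6.4.6**).

## References

* T. A. Springer, *Linear Algebraic Groups*, 2nd ed., Progress in Mathematics 9, Birkhäuser
  (1998), 1.8.2, 3.2.9, 5.1.6 (ii), 6.2.7, 6.4.2–6.4.6, 6.4.8 [SpringerLAG1998].
-/

noncomputable section

open MvPolynomial
open scoped Pointwise MatrixGroups

namespace Literature.NumberTheory.Automorphic

variable {k : Type*} [Field k]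

attribute [local instance] zariskiTopologyPi zariskiTopologyGL

/-! ### Dimension lemmas for subsets of affine space -/

section DimLemmas

variable {σ τ : Type*}

/-- **Isomorphic affine sets have the same dimension**: if `Φ : kⁿ → kᵐ` and `Ψ : kᵐ → kⁿ` are
polynomial maps with `Ψ ∘ Φ = id` on `X ⊆ kⁿ`, the comorphisms induce mutually inverse
isomorphisms `k[y] ⧸ I(Φ X) ≃ k[x] ⧸ I(X)`, so `dim Φ(X) = dim X` (Springer 1.4.7, 1.8.1).
[folklore] -/
theorem ringKrullDim_quotient_vanishingIdeal_image_eq {X : Set (σ → k)}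
    {Φ : (σ → k) → (τ → k)} (P : τ → MvPolynomial σ k)
    (hΦ : ∀ x t, Φ x t = MvPolynomial.eval x (P t))
    {Ψ : (τ → k) → (σ → k)} (Q : σ → MvPolynomial τ k)
    (hΨ : ∀ y s, Ψ y s = MvPolynomial.eval y (Q s)) (hinv : ∀ x ∈ X, Ψ (Φ x) = x) :
    ringKrullDim (MvPolynomial τ k ⧸ vanishingIdeal k (Φ '' X)) =
      ringKrullDim (MvPolynomial σ k ⧸ vanishingIdeal k X) := by
  set IX : Ideal (MvPolynomial σ k) := vanishingIdeal k X with hIXdef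
  set IY : Ideal (MvPolynomial τ k) := vanishingIdeal k (Φ '' X) with hIYdef
  set α : MvPolynomial τ k →ₐ[k] MvPolynomial σ k := MvPolynomial.bind₁ P with hαdef
  set β : MvPolynomial σ k →ₐ[k] MvPolynomial τ k := MvPolynomial.bind₁ Q with hβdef
  have hα : ∀ (x : σ → k) (p : MvPolynomial τ k),
      MvPolynomial.eval x (α p) = MvPolynomial.eval (Φ x) p := by
    intro x p
    rw [hαdef, eval_bind₁']
    have e : (fun t => MvPolynomial.eval x (P t)) = Φ x := funext fun t => (hΦ x t).symm
    rw [e]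
  have hβ : ∀ (y : τ → k) (q : MvPolynomial σ k),
      MvPolynomial.eval y (β q) = MvPolynomial.eval (Ψ y) q := by
    intro y q
    rw [hβdef, eval_bind₁']
    have e : (fun s => MvPolynomial.eval y (Q s)) = Ψ y := funext fun s => (hΨ y s).symm
    rw [e]
  have hmemX : ∀ {q : MvPolynomial σ k}, q ∈ IX ↔ ∀ x ∈ X, MvPolynomial.eval x q = 0 := by
    intro q
    rw [hIXdef, mem_vanishingIdeal_iff]
    simp only [MvPolynomial.aeval_eq_eval]
  have hmemY : ∀ {p : MvPolynomial τ k}, p ∈ IY ↔ ∀ x ∈ X, MvPolynomial.eval (Φ x) p = 0 := by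
    intro p
    rw [hIYdef, mem_vanishingIdeal_iff]
    simp only [MvPolynomial.aeval_eq_eval, Set.forall_mem_image]
  have h1 : IY ≤ IX.comap α.toRingHom := fun p hp => by
    rw [Ideal.mem_comap]
    refine hmemX.2 fun x hx => ?_
    change MvPolynomial.eval x (α p) = 0
    rw [hα]
    exact hmemY.1 hp x hx
  have h2 : IX ≤ IY.comap β.toRingHom := fun q hq => by
    rw [Ideal.mem_comap]
    refine hmemY.2 fun x hx => ?_
    change MvPolynomial.eval (Φ x) (β q) = 0
    rw [hβ, hinv x hx]
    exact hmemX.1 hq x hx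
  set a : MvPolynomial τ k ⧸ IY →+* MvPolynomial σ k ⧸ IX :=
    Ideal.quotientMap IX α.toRingHom h1 with hadef
  set b : MvPolynomial σ k ⧸ IX →+* MvPolynomial τ k ⧸ IY :=
    Ideal.quotientMap IY β.toRingHom h2 with hbdef
  have hab : ∀ z, a (b z) = z := by
    intro z
    obtain ⟨q, rfl⟩ := Ideal.Quotient.mk_surjective z
    rw [hbdef, Ideal.quotientMap_mk, hadef, Ideal.quotientMap_mk, Ideal.Quotient.eq]
    refine hmemX.2 fun x hx => ?_
    change MvPolynomial.eval x (α (β q) - q) = 0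
    rw [map_sub, hα, hβ, hinv x hx, sub_self]
  have hba : ∀ z, b (a z) = z := by
    intro z
    obtain ⟨p, rfl⟩ := Ideal.Quotient.mk_surjective z
    rw [hadef, Ideal.quotientMap_mk, hbdef, Ideal.quotientMap_mk, Ideal.Quotient.eq]
    refine hmemY.2 fun x hx => ?_
    change MvPolynomial.eval (Φ x) (β (α p) - p) = 0
    rw [map_sub, hβ, hinv x hx, hα, sub_self]
  exact ringKrullDim_eq_of_ringEquiv
    (RingEquiv.ofBijective a ⟨fun x y hxy => by simpa [hba] using congrArg b hxy,
      fun z => ⟨b z, hab z⟩⟩)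

/-- The dimension `dim k[x] ⧸ I(Z)` is monotone on subsets `Z ⊆ Z'`. [folklore] -/
theorem ringKrullDim_quotient_vanishingIdeal_mono {Z Z' : Set (σ → k)} (h : Z ⊆ Z') :
    ringKrullDim (MvPolynomial σ k ⧸ vanishingIdeal k Z) ≤
      ringKrullDim (MvPolynomial σ k ⧸ vanishingIdeal k Z') :=
  ringKrullDim_le_of_surjective
    (Ideal.quotientMap (vanishingIdeal k Z) (RingHom.id _)
      (by simpa using vanishingIdeal_anti_mono h))
    (Ideal.quotientMap_surjective (by exact Function.surjective_id))

/-- A point has dimension `0`: `k[x] ⧸ 𝔪_a` is a field (`𝔪_a = I({a})` is the kernel of the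
evaluation at `a`, a maximal ideal). [folklore] -/
theorem ringKrullDim_quotient_vanishingIdeal_singleton (a : σ → k) :
    ringKrullDim (MvPolynomial σ k ⧸ vanishingIdeal k ({a} : Set (σ → k))) = 0 :=
  ringKrullDim_eq_zero_of_isField
    ((Ideal.Quotient.maximal_ideal_iff_isField_quotient _).1 inferInstance)

variable [IsAlgClosed k]

/-- **Dimension of a product** (Springer 1.8.1/1.5.4: `dim (X × Y) = dim X + dim Y`), in the form
needed here: for closed irreducible `A ⊆ kⁿ`, `W ⊆ kᵐ` of dimensions `d`, `w` (natural numbers),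
`dim (A × W) = d + w`. Proof by the generic fibre theorem 5.1.6 (ii) for the first projection,
whose fibres `{a} × W` are isomorphic to `W`. [cite: SpringerLAG1998, 5.1.6 (ii)] -/
theorem ringKrullDim_quotient_vanishingIdeal_prodSet [Finite σ] [Finite τ] {A : Set (σ → k)} {W : Set (τ → k)}
    (hA : IsClosed A) (hAirr : IsIrreducible A) (hW : IsClosed W) (hWirr : IsIrreducible W)
    {d w : ℕ} (hd : ringKrullDim (MvPolynomial σ k ⧸ vanishingIdeal k A) = d)
    (hw : ringKrullDim (MvPolynomial τ k ⧸ vanishingIdeal k W) = w) :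
    ringKrullDim (MvPolynomial (σ ⊕ τ) k ⧸ vanishingIdeal k (prodSet A W)) = (d + w : ℕ) := by
  classical
  set V : Set (σ ⊕ τ → k) := prodSet A W with hVdef
  have hVcl : IsClosed V := isClosed_prodSet hA hW
  have hVirr : IsIrreducible V := isIrreducible_prodSet hAirr hWirr
  -- the first projection
  set φ : (σ ⊕ τ → k) → (σ → k) := fun v i => v (Sum.inl i) with hφdef
  obtain ⟨U, e, r, hU, hne, hdimW, hdimV, hfib⟩ :=
    exists_isOpen_ringKrullDim_fibre_eq hVcl hVirr (φ := φ) (fun i => MvPolynomial.X (Sum.inl i))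
      (fun v i => by simp [hφdef])
  -- `φ V = A`
  obtain ⟨b₀, hb₀⟩ := hWirr.nonempty
  have hφV : φ '' V = A := by
    apply Set.Subset.antisymm
    · rintro _ ⟨v, hv, rfl⟩
      exact hv.1
    · intro a ha
      exact ⟨Sum.elim a b₀, ⟨ha, hb₀⟩, rfl⟩
  rw [hφV, hA.closure_eq, hd] at hdimW
  have hed : e = d := by exact_mod_cast hdimW.symm
  -- a point of `U ∩ A` and the fibre `{a} × W` over it
  rw [hφV] at hne
  obtain ⟨a, haU, haA⟩ := hne
  set F : Set (σ ⊕ τ → k) := (fun b : τ → k => Sum.elim a b) '' W with hFdef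
  have hFfib : V ∩ φ ⁻¹' {a} = F := by
    apply Set.Subset.antisymm
    · rintro v ⟨hv, hva⟩
      rw [Set.mem_preimage, Set.mem_singleton_iff] at hva
      refine ⟨fun j => v (Sum.inr j), hv.2, ?_⟩
      rw [← hva]
      exact sumElim_inl_inr v
    · rintro _ ⟨b, hb, rfl⟩
      exact ⟨⟨by simpa using haA, by simpa using hb⟩, by
        rw [Set.mem_preimage, Set.mem_singleton_iff]; rfl⟩
  have hFirr : IsIrreducible F := hWirr.image _ (continuous_sumElim_right a).continuousOn
  have hFmax : Maximal (fun T : Set (σ ⊕ τ → k) => IsIrreducible T ∧ T ⊆ V ∩ φ ⁻¹' {a}) F :=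
    ⟨⟨hFirr, hFfib.symm.subset⟩, fun T hT _ => hFfib ▸ hT.2⟩
  have hrF := hfib a haU F hFmax
  -- `dim F = dim W`
  have hFW : ringKrullDim (MvPolynomial (σ ⊕ τ) k ⧸ vanishingIdeal k F) =
      ringKrullDim (MvPolynomial τ k ⧸ vanishingIdeal k W) := by
    refine ringKrullDim_quotient_vanishingIdeal_image_eq
      (Φ := fun b : τ → k => Sum.elim a b)
      (Sum.elim (fun i => MvPolynomial.C (a i)) fun j => MvPolynomial.X j)
      (fun b c => by cases c <;> simp)
      (Ψ := fun v j => v (Sum.inr j)) (fun j => MvPolynomial.X (Sum.inr j))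
      (fun v j => by simp) (fun b _ => ?_)
    funext j
    simp
  rw [hFW, hw] at hrF
  have hrw : r = w := by exact_mod_cast hrF.symm
  rw [hdimV, hed, hrw]

omit [IsAlgClosed k] in
/-- **A prime ideal strictly above `𝓘(G)` has quotient of dimension `< dim G`** (Springer 1.8.2:
proper closed irreducible subsets of an irreducible variety have smaller dimension; the variant
of `ZariskiGLDimension.IsZConnected.zdim_lt_of_lt` for primes). [cite: SpringerLAG1998, Prop 1.8.2] -/
theorem ringKrullDim_quotient_lt_zdim_of_lt {n : Type*} [Fintype n] [DecidableEq n]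
    {G : Subgroup (GL n k)} (hG : IsZConnected G) {P : Ideal (MvPolynomial (GLCoord n) k)}
    (hP : P.IsPrime) (hlt : vanishingIdeal k (glCoordFun '' (G : Set (GL n k))) < P) :
    ringKrullDim (MvPolynomial (GLCoord n) k ⧸ P) < ((hG.zdim : ℕ∞) : WithBot ℕ∞) := by
  let pZ : PrimeSpectrum (MvPolynomial (GLCoord n) k) := ⟨P, hP⟩
  have hlt' : hG.primePoint < pZ := by
    rw [← PrimeSpectrum.asIdeal_lt_asIdeal, IsZConnected.primePoint_asIdeal]
    exact hlt
  have hfin : Order.coheight pZ < ⊤ := by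
    have h1 := Order.coheight_le_krullDim pZ
    have h2 : Order.krullDim (PrimeSpectrum (MvPolynomial (GLCoord n) k)) =
        (Nat.card (GLCoord n) : WithBot ℕ∞) := ringKrullDim_mvPolynomial_glCoord
    rw [h2] at h1
    have h3 : Order.coheight pZ ≤ (Nat.card (GLCoord n) : ℕ∞) := by exact_mod_cast h1
    exact lt_of_le_of_lt h3 (ENat.coe_lt_top _)
  have hco : Order.coheight pZ < Order.coheight hG.primePoint := Order.coheight_strictAnti hlt' hfin
  have hdim : ringKrullDim (MvPolynomial (GLCoord n) k ⧸ P) =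
      ((Order.coheight pZ : ℕ∞) : WithBot ℕ∞) := by
    rw [Order.coheight_eq_krullDim_Ici, ringKrullDim_quotient]
    have hset : PrimeSpectrum.zeroLocus (R := MvPolynomial (GLCoord n) k) ↑P = Set.Ici pZ := by
      ext q
      rw [PrimeSpectrum.mem_zeroLocus, Set.mem_Ici, ← PrimeSpectrum.asIdeal_le_asIdeal]
      rfl
    rw [hset]
  rw [hdim, hG.coe_zdim]
  exact_mod_cast hco

omit [IsAlgClosed k] in
/-- **A closed irreducible subset of a connected algebraic group `G` of dimension `dim G` is all of
`G`** (Springer 1.8.2), in coordinates. [cite: SpringerLAG1998, Prop 1.8.2] -/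
theorem eq_image_of_ringKrullDim_eq_zdim {n : Type*} [Fintype n] [DecidableEq n]
    {G : Subgroup (GL n k)} (hG : IsZConnected G) {Z : Set (GLCoord n → k)} (hZ : IsClosed Z)
    (hZirr : IsIrreducible Z) (hZG : Z ⊆ glCoordFun '' (G : Set (GL n k)))
    (hdim : ringKrullDim (MvPolynomial (GLCoord n) k ⧸ vanishingIdeal k Z) =
      ((hG.zdim : ℕ∞) : WithBot ℕ∞)) :
    Z = glCoordFun '' (G : Set (GL n k)) := by
  have hle : vanishingIdeal k (glCoordFun '' (G : Set (GL n k))) ≤ vanishingIdeal k Z :=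
    vanishingIdeal_anti_mono hZG
  rcases hle.lt_or_eq with hlt | heq
  · have h := ringKrullDim_quotient_lt_zdim_of_lt hG (isPrime_vanishingIdeal_of_isIrreducible_pi hZirr) hlt
    rw [hdim] at h
    exact absurd h (lt_irrefl _)
  · have hGcl : IsClosed (glCoordFun '' (G : Set (GL n k))) :=
      isClosedEmbedding_glCoordFun.isClosedMap _ hG.1.isClosed
    rw [← zeroLocus_vanishingIdeal_of_isClosed hZ, ← heq, zeroLocus_vanishingIdeal_of_isClosed hGcl]

end DimLemmas

/-! ### Group-theoretic lemmas: tori, regular elements, Cartan subgroups -/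

section GroupLemmas

variable {n : Type*} [Fintype n] [DecidableEq n] {G T : Subgroup (GL n k)}

/-- The dimension of connected algebraic subgroups is monotone. [folklore] -/
lemma IsZConnected.zdim_mono {H H' : Subgroup (GL n k)} (hH : IsZConnected H) (hH' : IsZConnected H')
    (hle : H ≤ H') : hH.zdim ≤ hH'.zdim := by
  rcases hle.lt_or_eq with hlt | heq
  · exact (hH.zdim_lt_of_lt hH' hlt).le
  · subst heq
    exact le_rfl

/-- **Two commuting tori generate a torus**: if `T, T'` are tori whose elements commute, `T ⊔ T'`
is Zariski-connected (`isZConnected_sup`), commutative and consists of semisimple elements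
(products of commuting semisimple matrices are semisimple). [folklore] -/
theorem isTorusSubgroup_sup_of_commute [IsAlgClosed k] {T T' : Subgroup (GL n k)}
    (hT : IsTorusSubgroup T) (hT' : IsTorusSubgroup T')
    (hcomm : ∀ t ∈ T, ∀ s ∈ T', t * s = s * t) : IsTorusSubgroup (T ⊔ T') := by
  haveI : IsMulCommutative ↥T := hT.2.1
  let TT : Subgroup (GL n k) :=
    { carrier := {x | ∃ t ∈ T, ∃ s ∈ T', t * s = x}
      one_mem' := ⟨1, T.one_mem, 1, T'.one_mem, mul_one 1⟩
      mul_mem' := by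
        rintro _ _ ⟨t, ht, s, hs, rfl⟩ ⟨t', ht', s', hs', rfl⟩
        refine ⟨t * t', T.mul_mem ht ht', s * s', T'.mul_mem hs hs', ?_⟩
        calc t * t' * (s * s') = t * (t' * s) * s' := by group
          _ = t * (s * t') * s' := by rw [hcomm t' ht' s hs]
          _ = t * s * (t' * s') := by group
      inv_mem' := by
        rintro _ ⟨t, ht, s, hs, rfl⟩
        refine ⟨t⁻¹, T.inv_mem ht, s⁻¹, T'.inv_mem hs, ?_⟩
        rw [mul_inv_rev]
        exact (Commute.inv_inv (hcomm t ht s hs)).eq }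
  have hTTsup : T ⊔ T' = TT := by
    apply le_antisymm
    · exact sup_le (fun t ht => ⟨t, ht, 1, T'.one_mem, mul_one t⟩)
        (fun s hs => ⟨1, T.one_mem, s, hs, one_mul s⟩)
    · rintro _ ⟨t, ht, s, hs, rfl⟩
      exact (T ⊔ T').mul_mem (Subgroup.mem_sup_left ht) (Subgroup.mem_sup_right hs)
  refine ⟨isZConnected_sup hT.1 hT'.1, ⟨⟨fun a b => Subtype.ext ?_⟩⟩, fun x hx => ?_⟩
  · obtain ⟨t, ht, s, hs, ha⟩ := (hTTsup ▸ a.2 : (a : GL n k) ∈ TT)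
    obtain ⟨t', ht', s', hs', hb⟩ := (hTTsup ▸ b.2 : (b : GL n k) ∈ TT)
    change (a : GL n k) * b = b * a
    rw [← ha, ← hb]
    have h1 := congrArg Subtype.val (IsMulCommutative.is_comm.comm (⟨t, ht⟩ : ↥T) ⟨t', ht'⟩)
    have h2 := congrArg Subtype.val (hT'.2.1.is_comm.comm (⟨s, hs⟩ : ↥T') ⟨s', hs'⟩)
    simp only [Subgroup.coe_mul] at h1 h2
    calc t * s * (t' * s') = t * (s * t') * s' := by group
      _ = t * (t' * s) * s' := by rw [hcomm t' ht' s hs]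
      _ = (t * t') * (s * s') := by group
      _ = (t' * t) * (s' * s) := by rw [h1, h2]
      _ = t' * (t * s') * s := by group
      _ = t' * (s' * t) * s := by rw [hcomm t ht s' hs']
      _ = t' * s' * (t * s) := by group
  · obtain ⟨t, ht, s, hs, rfl⟩ := (hTTsup ▸ hx : x ∈ TT)
    unfold IsSemisimpleElt
    rw [Units.val_mul, Matrix.toLin'_mul]
    exact Module.End.IsSemisimple.mul_of_commute
      (commute_toLin'_iff.2 (congrArg Units.val (hcomm t ht s hs)))
      (hT.2.2 t ht) (hT'.2.2 s hs)

/-- Conjugates of a Jordan decomposition form a Jordan decomposition of the conjugate.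
[folklore] -/
theorem IsJordanDecomp.conj {g s u : GL n k} (h : IsJordanDecomp g s u) (x : GL n k) :
    IsJordanDecomp (x * g * x⁻¹) (x * s * x⁻¹) (x * u * x⁻¹) where
  semisimple := h.semisimple.conj x
  unipotent := h.unipotent.conj x
  mul_eq := by rw [← h.mul_eq]; group
  commute := by
    change x * s * x⁻¹ * (x * u * x⁻¹) = x * u * x⁻¹ * (x * s * x⁻¹)
    rw [show x * s * x⁻¹ * (x * u * x⁻¹) = x * (s * u) * x⁻¹ by group, h.commute.eq]
    group

variable [IsAlgClosed k]

/-- **Regular elements of a torus** (Springer 6.4.3: "*there exists `s ∈ S` with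
`Z_G(s) = Z_G(S)` … they form a dense open subset of `S`*"). For a torus `T ≤ GL n k` over an
algebraically closed field there is a Zariski open set `O` of coordinate space meeting `T` such
that every `t ∈ T` with coordinates in `O` is *regular*: a matrix commuting with `t` commutes
with all of `T`. Proof as printed: diagonalise `T` (2.4.2 (ii)); `O` is the locus where the
diagonal entries `i, j` of the conjugated matrix differ for every pair `(i, j)` at which some
element of `T` has different entries. [cite: SpringerLAG1998, Lemma 6.4.3] -/
theorem exists_isOpen_torusRegular (hT : IsTorusSubgroup T) :
    ∃ O : Set (GLCoord n → k), IsOpen O ∧ (∃ t ∈ T, glCoordFun t ∈ O) ∧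
      ∀ t ∈ T, glCoordFun t ∈ O → ∀ g : GL n k, g * t = t * g →
        g ∈ Subgroup.centralizer (T : Set (GL n k)) := by
  classical
  obtain ⟨a, ha⟩ := exists_conj_le_diagonalSubgroup hT.2.1 hT.2.2
  rw [MulEquiv.toMonoidHom_eq_coe] at ha
  -- `a t a⁻¹` is diagonal for `t ∈ T`
  have hdiag : ∀ t ∈ T, ∃ d : n → kˣ,
      ((a * t * a⁻¹ : GL n k) : Matrix n n k) = Matrix.diagonal fun i => (d i : k) := by
    intro t ht
    obtain ⟨d, hd⟩ := ha ⟨t, ht, rfl⟩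
    exact ⟨d, by rw [← coe_diagonalGL, hd]; rfl⟩
  -- the diagonal-entry polynomials `E i` of `g ↦ (a g a⁻¹) i i`
  let E : n → MvPolynomial (GLCoord n) k := fun i =>
    ∑ l, ∑ m, MvPolynomial.C ((a : Matrix n n k) i l * ((a⁻¹ : GL n k) : Matrix n n k) m i) *
      MvPolynomial.X (Sum.inl (l, m))
  have hE : ∀ (g : GL n k) (i : n), MvPolynomial.eval (glCoordFun g) (E i) =
      ((a * g * a⁻¹ : GL n k) : Matrix n n k) i i := by
    intro g i
    simp only [E, map_sum, map_mul, MvPolynomial.eval_C, MvPolynomial.eval_X, glCoordFun_inl,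
      Units.val_mul, Matrix.mul_apply, Finset.sum_mul]
    rw [Finset.sum_comm]
    refine Finset.sum_congr rfl fun m _ => Finset.sum_congr rfl fun l _ => ?_
    ring
  -- the bad pairs and the open set
  let BP : Set (n × n) := {p | ∃ t ∈ T,
    MvPolynomial.eval (glCoordFun t) (E p.1) ≠ MvPolynomial.eval (glCoordFun t) (E p.2)}
  let O : Set (GLCoord n → k) := {w | ∀ p ∈ BP, MvPolynomial.eval w (E p.1 - E p.2) ≠ 0}
  have hO : IsOpen O := by
    have hOeq : O = (⋃ p ∈ BP, {w : GLCoord n → k | MvPolynomial.aeval w (E p.1 - E p.2) = 0})ᶜ := by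
      ext w
      simp only [O, Set.mem_setOf_eq, Set.mem_compl_iff, Set.mem_iUnion, not_exists, exists_prop,
        not_and, MvPolynomial.aeval_eq_eval]
    rw [hOeq, isOpen_compl_iff]
    exact (Set.toFinite BP).isClosed_biUnion fun p _ => isClosed_setOf_eval_eq_zero _
  refine ⟨O, hO, ?_, ?_⟩
  · -- non-emptiness: `T` is irreducible and not covered by the proper closed `{E i = E j}`
    by_contra hne
    push Not at hne
    let K : n × n → Set (GL n k) := fun p =>
      {g | MvPolynomial.eval (glCoordFun g) (E p.1 - E p.2) = 0}
    have hKcl : ∀ p, IsClosed (K p) := fun p => by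
      have : K p = zeroLocusGL {E p.1 - E p.2} := by
        ext g; simp [K, zeroLocusGL]
      rw [this]
      exact isClosed_zeroLocusGL _
    have hcov : (T : Set (GL n k)) ⊆ ⋃₀ ↑((Set.toFinite BP).toFinset.image K) := by
      intro t ht
      have hto : glCoordFun t ∉ O := hne t ht
      simp only [O, Set.mem_setOf_eq, not_forall, not_not, exists_prop] at hto
      obtain ⟨p, hp, hp0⟩ := hto
      refine Set.mem_sUnion.2 ⟨K p, ?_, hp0⟩
      simp only [Finset.coe_image, Set.Finite.coe_toFinset]
      exact ⟨p, hp, rfl⟩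
    obtain ⟨z, hz, hTz⟩ := (isIrreducible_iff_sUnion_isClosed.1 hT.1.isIrreducible) _
      (by
        intro z hz
        simp only [Finset.mem_image, Set.Finite.mem_toFinset] at hz
        obtain ⟨p, -, rfl⟩ := hz
        exact hKcl p) hcov
    simp only [Finset.mem_image, Set.Finite.mem_toFinset] at hz
    obtain ⟨p, hp, rfl⟩ := hz
    obtain ⟨t, ht, hne'⟩ := hp
    have := hTz ht
    simp only [K, Set.mem_setOf_eq, map_sub, sub_eq_zero] at this
    exact hne' this
  · -- regularity
    intro t ht htO g hgt
    rw [Subgroup.mem_centralizer_iff]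
    intro s hs
    obtain ⟨dt, hdt⟩ := hdiag t ht
    obtain ⟨ds, hds⟩ := hdiag s hs
    -- `g' = a g a⁻¹` commutes with the diagonal matrix `a t a⁻¹`
    have hcomm_t : ((a * g * a⁻¹ : GL n k) : Matrix n n k) * (Matrix.diagonal fun i => (dt i : k)) =
        (Matrix.diagonal fun i => (dt i : k)) * ((a * g * a⁻¹ : GL n k) : Matrix n n k) := by
      rw [← hdt, ← Units.val_mul, ← Units.val_mul]
      congr 1
      rw [show a * g * a⁻¹ * (a * t * a⁻¹) = a * (g * t) * a⁻¹ by group, hgt]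
      group
    -- off-diagonal entries of `g'` vanish where `a t a⁻¹` has distinct entries
    have hzero : ∀ i j, (dt i : k) ≠ dt j → ((a * g * a⁻¹ : GL n k) : Matrix n n k) i j = 0 := by
      intro i j hij
      have h := congrFun (congrFun hcomm_t i) j
      rw [Matrix.mul_diagonal, Matrix.diagonal_mul] at h
      have h' : ((a * g * a⁻¹ : GL n k) : Matrix n n k) i j * ((dt j : k) - dt i) = 0 := by
        rw [mul_sub, h]; ring
      rcases mul_eq_zero.1 h' with h0 | h0
      · exact h0
      · exact absurd (sub_eq_zero.1 h0).symm hij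
    -- the entries of `a t a⁻¹` differ wherever those of `a s a⁻¹` do
    have hsep : ∀ i j, (ds i : k) ≠ ds j → (dt i : k) ≠ dt j := by
      intro i j hij
      have hp : (i, j) ∈ BP := by
        refine ⟨s, hs, ?_⟩
        rw [hE, hE, hds, Matrix.diagonal_apply_eq, Matrix.diagonal_apply_eq]
        exact hij
      have h := htO (i, j) hp
      rw [map_sub, sub_ne_zero, hE, hE, hdt, Matrix.diagonal_apply_eq, Matrix.diagonal_apply_eq] at h
      exact h
    -- hence `g'` commutes with `a s a⁻¹`
    have hcomm_s : ((a * g * a⁻¹ : GL n k) : Matrix n n k) * (Matrix.diagonal fun i => (ds i : k)) =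
        (Matrix.diagonal fun i => (ds i : k)) * ((a * g * a⁻¹ : GL n k) : Matrix n n k) := by
      ext i j
      rw [Matrix.mul_diagonal, Matrix.diagonal_mul]
      by_cases hij : (ds i : k) = ds j
      · rw [hij, mul_comm]
      · rw [hzero i j (hsep i j hij), mul_zero, zero_mul]
    rw [← hds, ← Units.val_mul, ← Units.val_mul] at hcomm_s
    have h := Units.val_injective hcomm_s
    -- `a (g s) a⁻¹ = a (s g) a⁻¹`
    have h' : a * (g * s) * a⁻¹ = a * (s * g) * a⁻¹ := by
      calc a * (g * s) * a⁻¹ = a * g * a⁻¹ * (a * s * a⁻¹) := by group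
        _ = a * s * a⁻¹ * (a * g * a⁻¹) := h
        _ = a * (s * g) * a⁻¹ := by group
    have h'' := mul_left_cancel (mul_right_cancel h')
    exact h''.symm

/-- **A maximal torus is normalised by whoever conjugates a regular element of it back into it**
(the argument of Springer 6.4.2 (ii): "*if `t` lies in a conjugate `gCg⁻¹` then `g⁻¹ t g ∈ T` and
`T ⊂ Z_G(g⁻¹tg)° = g⁻¹Tg` … it follows that `g ∈ N_G(T)`*"). Here: `T` a maximal torus of `G`,
`t ∈ T` regular (its centraliser is that of `T`), `g ∈ G` with `g t g⁻¹ ∈ T`; then `g⁻¹ T g`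
commutes with `T`, so `T · g⁻¹Tg` is a torus of `G` containing `T`, equal to `T` by maximality,
whence `g T g⁻¹ = T`. [cite: SpringerLAG1998, 6.4.2 (ii), proof] -/
theorem map_conj_eq_of_regular (hT : IsMaximalTorusIn T G) {t : GL n k}
    (hreg : ∀ g : GL n k, g * t = t * g → g ∈ Subgroup.centralizer (T : Set (GL n k)))
    {g : GL n k} (hg : g ∈ G) (hgt : g * t * g⁻¹ ∈ T) :
    T.map (MulAut.conj g : GL n k →* GL n k) = T := by
  have hTt : IsTorusSubgroup T := hT.2.1
  haveI : IsMulCommutative ↥T := hTt.2.1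
  set T'' : Subgroup (GL n k) := T.map (MulAut.conj g⁻¹ : GL n k →* GL n k) with hT''def
  have hmemT'' : ∀ {x : GL n k}, x ∈ T'' ↔ g * x * g⁻¹ ∈ T := by
    intro x
    rw [hT''def, mem_map_conj_iff, inv_inv]
  -- `T''` commutes with `T`
  have hcommT : ∀ a ∈ T, ∀ b ∈ T'', a * b = b * a := by
    intro a ha b hb
    have hb' : g * b * g⁻¹ ∈ T := hmemT''.1 hb
    -- `b` commutes with `t`
    have hbt : b * t = t * b := by
      have h1 : (g * b * g⁻¹) * (g * t * g⁻¹) = (g * t * g⁻¹) * (g * b * g⁻¹) :=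
        congrArg Subtype.val (IsMulCommutative.is_comm.comm (⟨_, hb'⟩ : ↥T) ⟨_, hgt⟩)
      have h2 : g * (b * t) * g⁻¹ = g * (t * b) * g⁻¹ := by
        calc g * (b * t) * g⁻¹ = (g * b * g⁻¹) * (g * t * g⁻¹) := by group
          _ = (g * t * g⁻¹) * (g * b * g⁻¹) := h1
          _ = g * (t * b) * g⁻¹ := by group
      exact mul_left_cancel (mul_right_cancel h2)
    exact (Subgroup.mem_centralizer_iff.1 (hreg b hbt)) a ha
  have hT''torus : IsTorusSubgroup T'' := hTt.map_conj g⁻¹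
  have hT''G : T'' ≤ G := by
    intro x hx
    have h := hmemT''.1 hx
    have := G.mul_mem (G.mul_mem (G.inv_mem hg) (hT.1 h)) hg
    rwa [show g⁻¹ * (g * x * g⁻¹) * g = x by group] at this
  have hsup : IsTorusSubgroup (T ⊔ T'') := isTorusSubgroup_sup_of_commute hTt hT''torus hcommT
  have hTeq : T ⊔ T'' = T := hT.2.2 (T ⊔ T'') le_sup_left (sup_le hT.1 hT''G) hsup
  have hT''T : T'' ≤ T := hTeq ▸ le_sup_right
  -- `T''` is a maximal torus of `G` as well, hence `T'' = T`
  have hT''max : IsMaximalTorusIn T'' G := by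
    have h := hT.map_conj g⁻¹
    rwa [RankOneOrbitData.map_conj_eq_of_mem (G.inv_mem hg)] at h
  have hT''eqT : T = T'' := hT''max.2.2 T hT''T hT.1 hTt
  calc T.map (MulAut.conj g : GL n k →* GL n k)
      = T''.map (MulAut.conj g : GL n k →* GL n k) := by rw [← hT''eqT]
    _ = T := by rw [hT''def, map_conj_map_conj_inv]

/-- **The Cartan subgroup is `T × C_u` elementwise**: for a maximal torus `T` of a connected `G`
and `c` in the Cartan subgroup `C = Z_G(T)°`, the semisimple part of `c` lies in `T` (and the
unipotent part in `C`). Proof: `C` is connected solvable (6.4.2 (i), `NilpotentBorel.lean`) with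
maximal torus `T`, so `c_s = t u` with `t ∈ T` and `u` unipotent (6.3.5 (iv)); as `T` is central
in `C`, `u = t⁻¹ c_s` is also semisimple, hence `u = 1`. [cite: SpringerLAG1998, 6.4.2 (i)] -/
theorem exists_isJordanDecomp_mem_of_mem_cartan (hG : IsZConnected G) (hT : IsMaximalTorusIn T G)
    {c : GL n k}
    (hc : c ∈ identityComponent (G ⊓ Subgroup.centralizer (T : Set (GL n k)))) :
    ∃ t ∈ T, ∃ u ∈ identityComponent (G ⊓ Subgroup.centralizer (T : Set (GL n k))),
      IsJordanDecomp c t u := by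
  set Z : Subgroup (GL n k) := G ⊓ Subgroup.centralizer (T : Set (GL n k)) with hZdef
  have hZalg : IsAlgebraicSubgroup Z := hG.1.inf (isAlgebraicSubgroup_centralizer_set _)
  have hCalg : IsAlgebraicSubgroup (identityComponent Z) := isAlgebraicSubgroup_identityComponent hZalg
  have hCconn : IsZConnected (identityComponent Z) := isZConnected_identityComponent hZalg
  have hCsolv : IsSolvable ↥(identityComponent Z) := isSolvable_identityComponent_centralizer hG hT
  have hCZ : identityComponent Z ≤ Z := identityComponent_le Z
  have hTt : IsTorusSubgroup T := hT.2.1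
  haveI : IsMulCommutative ↥T := hTt.2.1
  have hTZ : T ≤ Z := fun t ht => ⟨hT.1 ht, Subgroup.mem_centralizer_iff.2 fun s hs =>
    congrArg Subtype.val (hTt.2.1.is_comm.comm (⟨s, hs⟩ : ↥T) ⟨t, ht⟩)⟩
  have hTC : T ≤ identityComponent Z :=
    hTt.1.le_of_finiteIndex hTZ hCalg (finiteIndex_identityComponent hZalg)
  have hTmaxC : IsMaximalTorusIn T (identityComponent Z) :=
    ⟨hTC, hTt, fun T' h1 h2 h3 => hT.2.2 T' h1 (h2.trans (hCZ.trans inf_le_left)) h3⟩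
  obtain ⟨s, hs, u, hu, hJ⟩ := exists_isJordanDecomp_mem hCalg hc
  obtain ⟨t, ht, htu⟩ := hTmaxC.exists_mul_unipotent hCconn hCsolv hs
  -- `t⁻¹ s` is semisimple (commuting semisimple factors) and unipotent, hence `1`
  have hts : t * s = s * t := (Subgroup.mem_centralizer_iff.1 (hCZ hs).2) t ht
  have hss : IsSemisimpleElt (t⁻¹ * s) := by
    unfold IsSemisimpleElt
    rw [Units.val_mul, Matrix.toLin'_mul]
    refine Module.End.IsSemisimple.mul_of_commute (commute_toLin'_iff.2 ?_)
      (hTt.2.2 t ht).inv hJ.semisimple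
    have h : t⁻¹ * s = s * t⁻¹ := by
      rw [inv_mul_eq_iff_eq_mul, ← mul_assoc, hts, mul_assoc, mul_inv_cancel, mul_one]
    exact congrArg Units.val h
  have h1 : t⁻¹ * s = 1 := hss.eq_one_of_isUnipotentElt htu
  have hst : s = t := by
    rw [inv_mul_eq_one] at h1
    exact h1.symm
  subst hst
  exact ⟨s, ht, u, hu, hJ⟩

end GroupLemmas

/-! ### Density of the conjugates of the Cartan subgroup (Springer 6.4.4 (ii), 6.4.5 (iii)) -/

section Density

variable {n : Type*} [Fintype n] [DecidableEq n] {G T : Subgroup (GL n k)}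

/-- The coordinates of `x c x⁻¹` as polynomials in the coordinates of the pair `(x, c)`.
[folklore] -/
lemma exists_poly_conj_pair :
    ∃ P : GLCoord n → MvPolynomial (GLCoord n ⊕ GLCoord n) k, ∀ (x c : GL n k) (d : GLCoord n),
      glCoordFun (x * c * x⁻¹) d =
        MvPolynomial.eval (Sum.elim (glCoordFun x) (glCoordFun c)) (P d) := by
  obtain ⟨Q, hQ⟩ := exists_poly_conj (k := k) (ι := n)
  refine ⟨fun d => MvPolynomial.bind₁ (Sum.elim (fun e => MvPolynomial.rename Sum.inl (invPolyGL e))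
      (fun e => MvPolynomial.X (Sum.inr e))) (Q d), fun x c d => ?_⟩
  rw [eval_bind₁']
  have hv : (fun i => MvPolynomial.eval (Sum.elim (glCoordFun x) (glCoordFun c))
      (Sum.elim (fun e => MvPolynomial.rename Sum.inl (invPolyGL e))
        (fun e => MvPolynomial.X (Sum.inr e)) i)) = Sum.elim (glCoordFun x⁻¹) (glCoordFun c) := by
    funext i
    rcases i with e | e
    · simp only [Sum.elim_inl, MvPolynomial.eval_rename]
      rw [show (Sum.elim (glCoordFun x) (glCoordFun c) ∘ Sum.inl) = glCoordFun x from rfl,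
        eval_invPolyGL]
    · simp
  rw [hv, ← hQ x⁻¹ c d, inv_inv]

/-- The coordinates of `x⁻¹ y x` as polynomials in the coordinates of `x`, for a fixed `y`.
[folklore] -/
lemma exists_poly_inv_conj_fixed (y : GL n k) :
    ∃ Q : GLCoord n → MvPolynomial (GLCoord n) k, ∀ (x : GL n k) (d : GLCoord n),
      glCoordFun (x⁻¹ * y * x) d = MvPolynomial.eval (glCoordFun x) (Q d) := by
  obtain ⟨Q, hQ⟩ := exists_poly_conj (k := k) (ι := n)
  refine ⟨fun d => MvPolynomial.bind₁ (Sum.elim (fun e => MvPolynomial.X e)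
      (fun e => MvPolynomial.C (glCoordFun y e))) (Q d), fun x d => ?_⟩
  rw [eval_bind₁']
  have hv : (fun i => MvPolynomial.eval (glCoordFun x)
      (Sum.elim (fun e => MvPolynomial.X e) (fun e => MvPolynomial.C (glCoordFun y e)) i)) =
      Sum.elim (glCoordFun x) (glCoordFun y) := by
    funext i
    rcases i with e | e <;> simp
  rw [hv, ← hQ x y d]

variable [IsAlgClosed k]

/-- **The conjugates of the Cartan subgroup are dense** (Springer 6.4.4 (ii) applied as in 6.4.5
(iii): "*the union of the Cartan subgroups of `G` contains a dense open subset*"). For a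
Zariski-connected `G ≤ GL n k` over an algebraically closed field, a maximal torus `T` and the
Cartan subgroup `C = Z_G(T)°`, every element of `G` lies in the Zariski closure of
`⋃_{x ∈ G} x C x⁻¹`. Proof on `k`-points, following the printed dimension count: the map
`ψ : G × C → G`, `(x, c) ↦ x c x⁻¹` has source of dimension `dim G + dim C`; over a conjugate
of a *regular* element `c₀ = t₀ u₀` (`t₀ ∈ T` regular, 6.4.3) the fibre is
`{(x₀ m, m⁻¹ c₀ m) | m ∈ N_G(T)}` (Jordan decomposition and 6.4.2 (ii)), a finite union of copies
of `N_G(T)° ⊆ C` (rigidity 3.2.9); such points are dense in `G × C`, so by the generic fibre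
theorem 5.1.6 (ii) `dim ψ(G × C)⁻ ≥ dim G`, whence `ψ(G × C)⁻ = G` (1.8.2).
[cite: SpringerLAG1998, 6.4.4 (ii) and 6.4.5 (iii)] -/
theorem subset_closure_conj_cartan (hG : IsZConnected G) (hT : IsMaximalTorusIn T G) :
    (G : Set (GL n k)) ⊆ closure {y | ∃ x ∈ G,
      ∃ c ∈ identityComponent (G ⊓ Subgroup.centralizer (T : Set (GL n k))), y = x * c * x⁻¹} := by
  classical
  -- the Cartan subgroup `C = Z_G(T)°`
  set Z : Subgroup (GL n k) := G ⊓ Subgroup.centralizer (T : Set (GL n k)) with hZdef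
  have hZalg : IsAlgebraicSubgroup Z := hG.1.inf (isAlgebraicSubgroup_centralizer_set _)
  set C : Subgroup (GL n k) := identityComponent Z with hCdef
  have hCalg : IsAlgebraicSubgroup C := isAlgebraicSubgroup_identityComponent hZalg
  have hCconn : IsZConnected C := isZConnected_identityComponent hZalg
  have hCZ : C ≤ Z := identityComponent_le Z
  have hCG : C ≤ G := hCZ.trans inf_le_left
  have hTt : IsTorusSubgroup T := hT.2.1
  haveI : IsMulCommutative ↥T := hTt.2.1
  have hTZ : T ≤ Z := fun t ht => ⟨hT.1 ht, Subgroup.mem_centralizer_iff.2 fun s hs =>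
    congrArg Subtype.val (hTt.2.1.is_comm.comm (⟨s, hs⟩ : ↥T) ⟨t, ht⟩)⟩
  have hTC : T ≤ C := hTt.1.le_of_finiteIndex hTZ hCalg (finiteIndex_identityComponent hZalg)
  -- the normaliser `N = N_G(T)` and its identity component `N₀ ⊆ C`
  set N : Subgroup (GL n k) := G ⊓ Subgroup.normalizer (T : Set (GL n k)) with hNdef
  have hNalg : IsAlgebraicSubgroup N := hG.1.inf hTt.1.1.normalizer
  set N₀ : Subgroup (GL n k) := identityComponent N with hN₀def
  have hN₀conn : IsZConnected N₀ := isZConnected_identityComponent hNalg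
  have hN₀N : N₀ ≤ N := identityComponent_le N
  have hN₀cen : N₀ ≤ Subgroup.centralizer (T : Set (GL n k)) :=
    hN₀conn.le_centralizer_of_le_normalizer hTt.2.1 hTt.2.2 (hN₀N.trans inf_le_right)
  have hN₀Z : N₀ ≤ Z := le_inf (hN₀N.trans inf_le_left) hN₀cen
  have hN₀C : N₀ ≤ C := hN₀conn.le_of_finiteIndex hN₀Z hCalg (finiteIndex_identityComponent hZalg)
  have hdimN₀C : hN₀conn.zdim ≤ hCconn.zdim := hN₀conn.zdim_mono hCconn hN₀C
  -- regular elements of `T`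
  obtain ⟨O, hO, ⟨t₁, ht₁T, ht₁O⟩, hreg⟩ := exists_isOpen_torusRegular hTt
  -- coordinates
  set G' : Set (GLCoord n → k) := glCoordFun '' (G : Set (GL n k)) with hG'def
  set C' : Set (GLCoord n → k) := glCoordFun '' (C : Set (GL n k)) with hC'def
  have hG'cl : IsClosed G' := isClosedEmbedding_glCoordFun.isClosedMap _ hG.1.isClosed
  have hC'cl : IsClosed C' := isClosedEmbedding_glCoordFun.isClosedMap _ hCconn.1.isClosed
  have hG'irr : IsIrreducible G' := isIrreducible_image_glCoordFun hG.isIrreducible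
  have hC'irr : IsIrreducible C' := isIrreducible_image_glCoordFun hCconn.isIrreducible
  set V : Set (GLCoord n ⊕ GLCoord n → k) := prodSet G' C' with hVdef
  have hVcl : IsClosed V := isClosed_prodSet hG'cl hC'cl
  have hVirr : IsIrreducible V := isIrreducible_prodSet hG'irr hC'irr
  have hmemV : ∀ {v : GLCoord n ⊕ GLCoord n → k}, v ∈ V ↔
      ∃ x ∈ G, ∃ c ∈ C, v = Sum.elim (glCoordFun x) (glCoordFun c) := by
    intro v
    constructor
    · rintro ⟨⟨x, hx, hxv⟩, ⟨c, hc, hcv⟩⟩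
      refine ⟨x, hx, c, hc, ?_⟩
      rw [← sumElim_inl_inr v, ← hxv, ← hcv]
    · rintro ⟨x, hx, c, hc, rfl⟩
      exact ⟨⟨x, hx, rfl⟩, ⟨c, hc, rfl⟩⟩
  -- the conjugation map `ψ`
  obtain ⟨P, hP⟩ := exists_poly_conj_pair (k := k) (n := n)
  set ψ : (GLCoord n ⊕ GLCoord n → k) → (GLCoord n → k) := fun v d => MvPolynomial.eval v (P d)
    with hψdef
  have hψpt : ∀ x c : GL n k, ψ (Sum.elim (glCoordFun x) (glCoordFun c)) = glCoordFun (x * c * x⁻¹) :=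
    fun x c => funext fun d => (hP x c d).symm
  have hψ_cont : Continuous ψ := continuous_of_polynomialMap P fun v d => rfl
  have hψV : ψ '' V = glCoordFun '' {y | ∃ x ∈ G, ∃ c ∈ C, y = x * c * x⁻¹} := by
    apply Set.Subset.antisymm
    · rintro _ ⟨v, hv, rfl⟩
      obtain ⟨x, hx, c, hc, rfl⟩ := hmemV.1 hv
      exact ⟨x * c * x⁻¹, ⟨x, hx, c, hc, rfl⟩, (hψpt x c).symm⟩
    · rintro _ ⟨_, ⟨x, hx, c, hc, rfl⟩, rfl⟩
      exact ⟨_, hmemV.2 ⟨x, hx, c, hc, rfl⟩, hψpt x c⟩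
  have hψVG : ψ '' V ⊆ G' := by
    rw [hψV]
    rintro _ ⟨_, ⟨x, hx, c, hc, rfl⟩, rfl⟩
    exact ⟨_, G.mul_mem (G.mul_mem hx (hCG hc)) (G.inv_mem hx), rfl⟩
  -- the generic fibre theorem
  obtain ⟨U₀, e, r, hU₀, hne, hdimW, hdimV, hfib⟩ :=
    exists_isOpen_ringKrullDim_fibre_eq hVcl hVirr (φ := ψ) P (fun v d => rfl)
  -- `dim V = dim G + dim C`
  have hdG : ringKrullDim (MvPolynomial (GLCoord n) k ⧸ vanishingIdeal k G') = (hG.zdim : ℕ) := by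
    have h := hG.coe_zdim_eq_ringKrullDim_quotient
    rw [← hG'def] at h
    exact_mod_cast h.symm
  have hdC : ringKrullDim (MvPolynomial (GLCoord n) k ⧸ vanishingIdeal k C') = (hCconn.zdim : ℕ) := by
    have h := hCconn.coe_zdim_eq_ringKrullDim_quotient
    rw [← hC'def] at h
    exact_mod_cast h.symm
  have hdimV' := ringKrullDim_quotient_vanishingIdeal_prodSet hG'cl hG'irr hC'cl hC'irr hdG hdC
  rw [← hVdef] at hdimV'
  have her : e + r = hG.zdim + hCconn.zdim := by
    have h := hdimV.symm.trans hdimV'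
    exact_mod_cast h
  -- a regular point `(x₀, t₀ u₀)` of `V` with `ψ`-image in `U₀`
  set R : Set (GLCoord n ⊕ GLCoord n → k) := {v | ∃ x ∈ G, ∃ t ∈ T, glCoordFun t ∈ O ∧
    ∃ u ∈ C, IsUnipotentElt u ∧ v = Sum.elim (glCoordFun x) (glCoordFun (t * u))} with hRdef
  have hVR : V ⊆ closure R := by
    intro v hv
    obtain ⟨x, hx, c, hc, rfl⟩ := hmemV.1 hv
    -- `c = t u` with `t ∈ T`, `u ∈ C` unipotent
    obtain ⟨t, ht, u, hu, hJ⟩ := exists_isJordanDecomp_mem_of_mem_cartan hG hT hc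
    -- the regular elements are dense in `T`
    have hTdense : (T : Set (GL n k)) ⊆ closure ((T : Set (GL n k)) ∩ glCoordFun ⁻¹' O) :=
      subset_closure_inter_of_isPreirreducible_of_isOpen hTt.1.isIrreducible.isPreirreducible
        (hO.preimage continuous_glCoordFun) ⟨t₁, ht₁T, ht₁O⟩
    -- the continuous map `t' ↦ (x, t' u)`
    let sl : GL n k → (GLCoord n ⊕ GLCoord n → k) := fun t' =>
      Sum.elim (glCoordFun x) (glCoordFun (t' * u))
    have hsl : Continuous sl :=
      (continuous_sumElim_right (glCoordFun x)).comp
        (continuous_glCoordFun.comp (continuous_mul_right_zariski u))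
    have h1 : sl t ∈ closure (sl '' ((T : Set (GL n k)) ∩ glCoordFun ⁻¹' O)) :=
      image_closure_subset_closure_image hsl ⟨t, hTdense ht, rfl⟩
    have h2 : sl '' ((T : Set (GL n k)) ∩ glCoordFun ⁻¹' O) ⊆ R := by
      rintro _ ⟨t', ⟨ht'T, ht'O⟩, rfl⟩
      exact ⟨x, hx, t', ht'T, ht'O, u, hu, hJ.unipotent, rfl⟩
    have h3 : sl t = Sum.elim (glCoordFun x) (glCoordFun c) := by
      simp only [sl, hJ.mul_eq]
    rw [← h3]
    exact closure_mono h2 h1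
  obtain ⟨v₁, hv₁U, hv₁V⟩ : (ψ ⁻¹' U₀ ∩ V).Nonempty := by
    obtain ⟨_, hyU, v₁, hv₁, rfl⟩ := hne
    exact ⟨v₁, hyU, hv₁⟩
  obtain ⟨v₀, hv₀U, hv₀R⟩ : (ψ ⁻¹' U₀ ∩ R).Nonempty :=
    mem_closure_iff.1 (hVR hv₁V) _ (hU₀.preimage hψ_cont) hv₁U
  obtain ⟨x₀, hx₀, t₀, ht₀, ht₀O, u₀, hu₀, hu₀unip, rfl⟩ := hv₀R
  set c₀ : GL n k := t₀ * u₀ with hc₀def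
  have hc₀C : c₀ ∈ C := C.mul_mem (hTC ht₀) hu₀
  set y₀ : GL n k := x₀ * c₀ * x₀⁻¹ with hy₀def
  have hy₀U : glCoordFun y₀ ∈ U₀ := by
    have h : ψ (Sum.elim (glCoordFun x₀) (glCoordFun c₀)) ∈ U₀ := hv₀U
    rwa [hψpt] at h
  have hJ₀ : IsJordanDecomp c₀ t₀ u₀ :=
    ⟨hTt.2.2 t₀ ht₀, hu₀unip, rfl, (Subgroup.mem_centralizer_iff.1 (hCZ hu₀).2) t₀ ht₀⟩
  have hreg₀ := hreg t₀ ht₀ ht₀O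
  -- the graph map `Θ : x ↦ (x, x⁻¹ y₀ x)` and its polynomial description
  obtain ⟨Qy, hQy⟩ := exists_poly_inv_conj_fixed (k := k) y₀
  set Θ : (GLCoord n → k) → (GLCoord n ⊕ GLCoord n → k) :=
    fun w => Sum.elim w fun d => MvPolynomial.eval w (Qy d) with hΘdef
  have hΘpt : ∀ x : GL n k, Θ (glCoordFun x) = Sum.elim (glCoordFun x) (glCoordFun (x⁻¹ * y₀ * x)) :=
    fun x => by
      simp only [hΘdef]
      congr 1
      funext d
      exact (hQy x d).symm
  have hΘpoly : ∀ w t, Θ w t = MvPolynomial.eval w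
      (Sum.elim (fun d => MvPolynomial.X d) Qy t) := fun w t => by
    rcases t with d | d <;> simp [hΘdef]
  have hΘcont : Continuous Θ := continuous_of_polynomialMap _ hΘpoly
  have hΘinj : ∀ w w', Θ w = Θ w' → w = w' := fun w w' h =>
    funext fun d => congrFun h (Sum.inl d)
  -- images of closed subsets of coordinate space under `Θ` are closed (closed graph)
  have hΘclosed : ∀ A : Set (GLCoord n → k), IsClosed A → IsClosed (Θ '' A) := by
    intro A hA
    have heq : Θ '' A = prodSet A Set.univ ∩
        {v | ∀ d, MvPolynomial.aeval v (MvPolynomial.X (Sum.inr d) -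
          MvPolynomial.rename Sum.inl (Qy d)) = 0} := by
      apply Set.Subset.antisymm
      · rintro _ ⟨w, hw, rfl⟩
        refine ⟨⟨by simpa [hΘdef] using hw, Set.mem_univ _⟩, fun d => ?_⟩
        simp only [MvPolynomial.aeval_eq_eval, map_sub, MvPolynomial.eval_X,
          MvPolynomial.eval_rename, hΘdef, Sum.elim_inr]
        rw [show (Sum.elim w (fun d => MvPolynomial.eval w (Qy d)) ∘ Sum.inl) = w from rfl, sub_self]
      · rintro v ⟨⟨hvA, -⟩, hv⟩
        refine ⟨fun d => v (Sum.inl d), hvA, ?_⟩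
        rw [← sumElim_inl_inr v]
        simp only [hΘdef]
        congr 1
        · funext d
          have h := hv d
          simp only [MvPolynomial.aeval_eq_eval, map_sub, MvPolynomial.eval_X,
            MvPolynomial.eval_rename, sub_eq_zero] at h
          rw [h]
          rfl
    rw [heq]
    refine (isClosed_prodSet hA isClosed_univ).inter ?_
    have : {v : GLCoord n ⊕ GLCoord n → k | ∀ d, MvPolynomial.aeval v (MvPolynomial.X (Sum.inr d) -
        MvPolynomial.rename Sum.inl (Qy d)) = 0} =
        ⋂ d, {v | MvPolynomial.aeval v (MvPolynomial.X (Sum.inr d) -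
          MvPolynomial.rename Sum.inl (Qy d)) = 0} := by
      ext v; simp
    rw [this]
    exact isClosed_iInter fun d => isClosed_setOf_eval_eq_zero _
  -- the pieces of the fibre over `y₀`: `Θ (x₀ m N₀)`, `m ∈ N / N₀`
  set Qt := ↥N ⧸ (N₀.subgroupOf N) with hQtdef
  haveI : (N₀.subgroupOf N).FiniteIndex := finiteIndex_identityComponent hNalg
  haveI : Finite Qt := Subgroup.finite_quotient_of_finiteIndex
  haveI : Fintype Qt := Fintype.ofFinite Qt
  set piece : Qt → Set (GLCoord n ⊕ GLCoord n → k) := fun q =>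
    Θ '' (glCoordFun '' ((x₀ * ((Quotient.out q : ↥N) : GL n k)) • (N₀ : Set (GL n k)))) with hpiecedef
  have hpiece_cl : ∀ q, IsClosed (piece q) := fun q =>
    hΘclosed _ (isClosedEmbedding_glCoordFun.isClosedMap _ (by
      rw [← image_zariskiMulLeft]
      exact (zariskiMulLeft _).isClosedMap _ hN₀conn.1.isClosed))
  set Zf : Set (GLCoord n ⊕ GLCoord n → k) :=
    Θ '' (glCoordFun '' (x₀ • (N₀ : Set (GL n k)))) with hZfdef
  -- (F1) the fibre lies in the union of the pieces
  have hfibre : V ∩ ψ ⁻¹' {glCoordFun y₀} ⊆ ⋃ q, piece q := by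
    rintro v ⟨hv, hvy⟩
    obtain ⟨x, hx, c, hc, rfl⟩ := hmemV.1 hv
    rw [Set.mem_preimage, hψpt, Set.mem_singleton_iff] at hvy
    have hxc : x * c * x⁻¹ = y₀ := glCoordFun_injective hvy
    set h : GL n k := x⁻¹ * x₀ with hhdef
    have hhG : h ∈ G := G.mul_mem (G.inv_mem hx) hx₀
    have hceq : c = h * c₀ * h⁻¹ := by
      rw [hhdef, _root_.mul_inv_rev, inv_inv]
      rw [hy₀def] at hxc
      rw [show x⁻¹ * x₀ * c₀ * (x₀⁻¹ * x) = x⁻¹ * (x₀ * c₀ * x₀⁻¹) * x by group, ← hxc]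
      group
    -- the semisimple part of `c` is `h t₀ h⁻¹` and lies in `T`
    obtain ⟨t, ht, u, -, hJc⟩ := exists_isJordanDecomp_mem_of_mem_cartan hG hT hc
    have hJc' : IsJordanDecomp c (h * t₀ * h⁻¹) (h * u₀ * h⁻¹) := by
      rw [hceq]; exact hJ₀.conj h
    have hteq : t = h * t₀ * h⁻¹ := (hJc.unique hJc').1
    have hconjT : h * t₀ * h⁻¹ ∈ T := hteq ▸ ht
    have hhN : h ∈ N :=
      ⟨hhG, Subgroup.mem_normalizer_iff_map_conj_eq.mpr
        (map_conj_eq_of_regular hT hreg₀ hhG hconjT)⟩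
    -- `x = x₀ h⁻¹ ∈ x₀ N`
    have hxeq : x = x₀ * h⁻¹ := by rw [hhdef]; group
    have hs : h⁻¹ ∈ N := N.inv_mem hhN
    obtain ⟨m, hm⟩ := QuotientGroup.mk_out_eq_mul (N₀.subgroupOf N) (⟨h⁻¹, hs⟩ : ↥N)
    refine Set.mem_iUnion.2 ⟨QuotientGroup.mk (⟨h⁻¹, hs⟩ : ↥N), ?_⟩
    simp only [hpiecedef]
    refine ⟨glCoordFun x, ⟨x, Set.mem_smul_set.2 ⟨((m : ↥N) : GL n k)⁻¹,
      N₀.inv_mem (Subgroup.mem_subgroupOf.1 m.2), ?_⟩, rfl⟩, ?_⟩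
    · have hm' := congrArg (fun s : ↥N => (s : GL n k)) hm
      simp only [Subgroup.coe_mul] at hm'
      rw [smul_eq_mul, hxeq, hm']
      group
    · rw [hΘpt, hceq, hhdef, hy₀def]
      congr 2
      group
  -- (F2)–(F4): `Zf` is an irreducible component of the fibre
  have hZfmax : Maximal (fun T' : Set (GLCoord n ⊕ GLCoord n → k) =>
      IsIrreducible T' ∧ T' ⊆ V ∩ ψ ⁻¹' {glCoordFun y₀}) Zf := by
    refine ⟨⟨?_, ?_⟩, fun T' ⟨hT'irr, hT'F⟩ hZT' => ?_⟩
    · rw [hZfdef, ← image_zariskiMulLeft]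
      exact (isIrreducible_image_glCoordFun
        (hN₀conn.isIrreducible.image _ (zariskiMulLeft x₀).continuous.continuousOn)).image _
        hΘcont.continuousOn
    · rintro _ ⟨_, ⟨_, ⟨m, hm, rfl⟩, rfl⟩, rfl⟩
      have hmG : (m : GL n k) ∈ G := (hN₀N hm).1
      have hxG : x₀ * m ∈ G := G.mul_mem hx₀ hmG
      rw [hΘpt]
      have hcC : (x₀ * m)⁻¹ * y₀ * (x₀ * m) ∈ C := by
        rw [hy₀def, show (x₀ * m)⁻¹ * (x₀ * c₀ * x₀⁻¹) * (x₀ * m) = m⁻¹ * c₀ * m by group]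
        exact C.mul_mem (C.mul_mem (C.inv_mem (hN₀C hm)) hc₀C) (hN₀C hm)
      refine ⟨hmemV.2 ⟨x₀ * m, hxG, _, hcC, rfl⟩, ?_⟩
      rw [Set.mem_preimage, hψpt, Set.mem_singleton_iff]
      congr 1
      group
    · obtain ⟨z, hz, hTz⟩ := (isIrreducible_iff_sUnion_isClosed.1 hT'irr)
        (Finset.univ.image piece) (by
          simp only [Finset.mem_image, Finset.mem_univ, true_and, forall_exists_index,
            forall_apply_eq_imp_iff]
          exact hpiece_cl)
        (fun v hv => by
          obtain ⟨q, hq⟩ := Set.mem_iUnion.1 (hfibre (hT'F hv))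
          exact Set.mem_sUnion.2 ⟨piece q, by simp, hq⟩)
      obtain ⟨q, -, rfl⟩ := Finset.mem_image.1 hz
      have hx₀Z : Θ (glCoordFun x₀) ∈ Zf :=
        ⟨glCoordFun x₀, ⟨x₀, Set.mem_smul_set.2 ⟨1, N₀.one_mem, mul_one x₀⟩, rfl⟩, rfl⟩
      obtain ⟨_, ⟨_, ⟨m, hm, rfl⟩, rfl⟩, hgm⟩ := hTz (hZT' hx₀Z)
      have hgm' := glCoordFun_injective (hΘinj _ _ hgm)
      have hout : ((Quotient.out q : ↥N) : GL n k) ∈ N₀ := by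
        have h1 : ((Quotient.out q : ↥N) : GL n k) = m⁻¹ := by
          have h2 : x₀ * ((Quotient.out q : ↥N) : GL n k) * m = x₀ := hgm'
          rw [mul_assoc] at h2
          have h3 : ((Quotient.out q : ↥N) : GL n k) * m = 1 :=
            mul_left_cancel (by rw [h2, mul_one])
          exact eq_inv_of_mul_eq_one_left h3
        rw [h1]
        exact N₀.inv_mem hm
      have hq : piece q = Zf := by
        simp only [hpiecedef, hZfdef]
        rw [mul_smul, smul_coe_set hout]
      rw [← hq]
      exact hTz
  -- (F5) `dim Zf = dim N₀ = r`
  have hdimZf := hfib (glCoordFun y₀) hy₀U Zf hZfmax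
  have hdimZf' : ringKrullDim (MvPolynomial (GLCoord n ⊕ GLCoord n) k ⧸ vanishingIdeal k Zf) =
      ((hN₀conn.zdim : ℕ∞) : WithBot ℕ∞) := by
    rw [hZfdef, ringKrullDim_quotient_vanishingIdeal_image_eq (Φ := Θ)
      (Sum.elim (fun d => MvPolynomial.X d) Qy) hΘpoly (Ψ := fun v d => v (Sum.inl d))
      (fun d => MvPolynomial.X (Sum.inl d)) (fun v d => by simp) (fun w _ => rfl),
      ringKrullDim_quotient_vanishingIdeal_smul_eq, hN₀conn.coe_zdim_eq_ringKrullDim_quotient]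
  rw [hdimZf'] at hdimZf
  have hrN₀ : hN₀conn.zdim = r := by exact_mod_cast hdimZf
  -- `dim ψ(V)⁻ = e ≥ dim G`, hence `= dim G` and `ψ(V)⁻ = G`
  have he_le : (e : WithBot ℕ∞) ≤ ((hG.zdim : ℕ∞) : WithBot ℕ∞) := by
    rw [← hdimW, hG.coe_zdim_eq_ringKrullDim_quotient, ← hG'def]
    exact ringKrullDim_quotient_vanishingIdeal_mono (closure_minimal hψVG hG'cl)
  have he_le' : e ≤ hG.zdim := by exact_mod_cast he_le
  have he : e = hG.zdim := by omega
  have hcl : closure (ψ '' V) = G' :=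
    eq_image_of_ringKrullDim_eq_zdim hG isClosed_closure
      ((hVirr.image ψ hψ_cont.continuousOn).closure) (closure_minimal hψVG hG'cl)
      (by rw [hdimW, he]; rfl)
  -- back to `GL n k`
  intro g hg
  rw [isInducing_glCoordFun.closure_eq_preimage_closure_image, Set.mem_preimage, ← hψV, hcl]
  exact ⟨g, hg, rfl⟩

end Density

/-! ### Every element of a connected group lies in a Borel subgroup (Springer 6.4.5 (i)) -/

section Covering

variable {n : Type*} [Fintype n] [DecidableEq n] [IsAlgClosed k] {G B T : Subgroup (GL n k)}

omit [IsAlgClosed k] in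
/-- The trivial subgroup is a torus. [folklore] -/
lemma isTorusSubgroup_bot : IsTorusSubgroup (⊥ : Subgroup (GL n k)) := by
  refine ⟨isZConnected_bot, ⟨⟨fun a b => ?_⟩⟩, fun t ht => ?_⟩
  · have ha : (a : GL n k) = 1 := Subgroup.mem_bot.1 a.2
    have hb : (b : GL n k) = 1 := Subgroup.mem_bot.1 b.2
    exact Subtype.ext (by rw [Subgroup.coe_mul, Subgroup.coe_mul, ha, hb])
  · rw [Subgroup.mem_bot] at ht
    subst ht
    simp [IsSemisimpleElt, Module.End.isSemisimple_id]

omit [IsAlgClosed k] in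
/-- **Every connected linear algebraic group has a maximal torus** (Springer 6.3.5 (i) with
6.3.6 (i) / 6.4.1; on `k`-points: a torus of `G` of maximal dimension containing the trivial
torus). [cite: SpringerLAG1998, 6.4.1] -/
theorem exists_isMaximalTorusIn (G : Subgroup (GL n k)) : ∃ T : Subgroup (GL n k), IsMaximalTorusIn T G := by
  obtain ⟨T, hT, -⟩ := exists_isMaximalTorusIn_ge (G := G) isTorusSubgroup_bot bot_le
  exact ⟨T, hT⟩

/-- **Springer 6.4.5 (i) for a Borel subgroup containing a maximal torus**: every element of the
Zariski-connected `G` is conjugate into `B ⊇ T`. Indeed the union `X` of the conjugates of `B` is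
closed (6.4.4 (i), `IsCompleteQuotient.isClosed_setOf_exists_conj_mem` with 6.2.7 (ii)) and
contains the conjugates of the Cartan subgroup `C = Z_G(T)° ⊆ B` (6.4.8 (ii),
`centralizer_le_of_isBorelIn_holds`), which are dense (`subset_closure_conj_cartan`).
[cite: SpringerLAG1998, 6.4.5 (i)] -/
theorem exists_inv_conj_mem_of_isBorelIn_of_torus_le (hG : IsZConnected G)
    (hT : IsMaximalTorusIn T G) (hB : IsBorelIn B G) (hTB : T ≤ B) {g : GL n k} (hg : g ∈ G) :
    ∃ x ∈ G, x⁻¹ * g * x ∈ B := by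
  have hXcl : IsClosed {y : GL n k | ∃ x ∈ G, x⁻¹ * y * x ∈ B} :=
    (hB.isCompleteQuotient hG).isClosed_setOf_exists_conj_mem hG.1 hB.2.1.1 hB.1
  have hZB : G ⊓ Subgroup.centralizer (T : Set (GL n k)) ≤ B :=
    centralizer_le_of_isBorelIn_holds hG hT hB hTB
  have hsub : {y : GL n k | ∃ x ∈ G,
      ∃ c ∈ identityComponent (G ⊓ Subgroup.centralizer (T : Set (GL n k))), y = x * c * x⁻¹} ⊆
      {y : GL n k | ∃ x ∈ G, x⁻¹ * y * x ∈ B} := by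
    rintro _ ⟨x, hx, c, hc, rfl⟩
    refine ⟨x, hx, ?_⟩
    rw [show x⁻¹ * (x * c * x⁻¹) * x = c by group]
    exact hZB (identityComponent_le _ hc)
  exact closure_minimal hsub hXcl (subset_closure_conj_cartan hG hT hg)

/-- **Springer 6.4.5 (i): every element of a connected linear algebraic group lies in a Borel
subgroup** — equivalently (all Borel subgroups being conjugate, 6.2.7 (iii)) every element is
conjugate into any given Borel subgroup `B`: for `G ≤ GL n k` Zariski-connected over an
algebraically closed field, `B` a Borel subgroup of `G` and `g ∈ G`, there is `x ∈ G` with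
`x⁻¹ g x ∈ B`, i.e. `G = ⋃_{x ∈ G} x B x⁻¹`. [cite: SpringerLAG1998, Thm 6.4.5 (i)] -/
theorem IsBorelIn.exists_inv_conj_mem (hB : IsBorelIn B G) (hG : IsZConnected G) {g : GL n k}
    (hg : g ∈ G) : ∃ x ∈ G, x⁻¹ * g * x ∈ B := by
  obtain ⟨T, hT⟩ := exists_isMaximalTorusIn G
  obtain ⟨B₀, hB₀, hTB₀⟩ := hT.2.1.exists_isBorelIn_ge hT.1
  obtain ⟨x, hx, hxg⟩ := exists_inv_conj_mem_of_isBorelIn_of_torus_le hG hT hB₀ hTB₀ hg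
  obtain ⟨y, hy, hBeq⟩ := isBorelIn_conj_holds hG hB₀ hB
  refine ⟨x * y⁻¹, G.mul_mem hx (G.inv_mem hy), ?_⟩
  rw [hBeq, mem_map_conj_iff, show y⁻¹ * ((x * y⁻¹)⁻¹ * g * (x * y⁻¹)) * y = x⁻¹ * g * x by group]
  exact hxg

/-- **Springer 6.4.5 (i), membership form**: every element of a Zariski-connected `G ≤ GL n k`
(over an algebraically closed field) lies in some Borel subgroup of `G`.
[cite: SpringerLAG1998, Thm 6.4.5 (i)] -/
theorem exists_isBorelIn_mem (hG : IsZConnected G) {g : GL n k} (hg : g ∈ G) :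
    ∃ B : Subgroup (GL n k), IsBorelIn B G ∧ g ∈ B := by
  obtain ⟨T, hT⟩ := exists_isMaximalTorusIn G
  obtain ⟨B₀, hB₀, -⟩ := hT.2.1.exists_isBorelIn_ge hT.1
  obtain ⟨x, hx, hxg⟩ := hB₀.exists_inv_conj_mem hG hg
  refine ⟨B₀.map (MulAut.conj x : GL n k →* GL n k), hB₀.map_conj hx, ?_⟩
  rw [mem_map_conj_iff]
  exact hxg

/-- **Springer 6.4.6: `C(B) = C(G)`** in the form: the centre of `G` lies in every Borel
subgroup (an element of the centre lies in a Borel subgroup by 6.4.5 (i), hence in all of them by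
conjugacy). [cite: SpringerLAG1998, Cor 6.4.6] -/
theorem center_le_of_isBorelIn (hG : IsZConnected G) (hB : IsBorelIn B G) :
    G ⊓ Subgroup.centralizer (G : Set (GL n k)) ≤ B := by
  rintro g ⟨hg, hgc⟩
  obtain ⟨x, hx, hxg⟩ := hB.exists_inv_conj_mem hG hg
  have h : x⁻¹ * g * x = g := by
    rw [mul_assoc, ← (Subgroup.mem_centralizer_iff.1 hgc) x hx, ← mul_assoc, inv_mul_cancel, one_mul]
  rwa [h] at hxg

end Covering

end Literature.NumberTheory.Automorphic
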